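import Summits.CriticalPhenomena.PercolationContinuityZ3.Theorems.PercNearOneGluingNoHeavyPcintLoopExclusionRungTenZ2
import Summits.CriticalPhenomena.PercolationContinuityZ3.Theorems.PercNearOneGluingNoHeavyPcintLoopExclusionRungEightZ4
import HarnessLib

/-!
# CriticalPhenomena/PercolationContinuityZ3 — Theorems/PercNearOneGluingNoHeavyPcintLoopExclusionTable.lean: the certified factor table of the typed law C4 — `R_τ(ℤ^d)` for `(d, τ) ∈ {2,3,4} × {4,6,8}` and `(2,10)`

Lane prim-pcint, STRUCTURE rule (one citable statement).  The loop-exclusion factor `R_τ(d) = Δ_τ/f_τ` (…PcintLoopExclusionLaw;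
`Δ_τ = ln(μ_{τ−2}/μ_τ)`, `f_τ = 2τ·p_τ/μ_{τ−2}^τ`) is certified by two-sided kernel certificates for the memory growth constants
(…MemCertZ2, …MemCertZ2T10Upper/Lower, …MemCertZ3T6, …MemCertZ3T8TwoSided, …RungSixZ4, …MemCertZ4T8), exact or witnessed polygon
counts by kernel (…ClosingCountKernel, …ClosingCountKernelZ2, …ClosingOctagonsZ3Exact, …ClosingDecagonsZ2Exact, …ClosingOctagonsZ4) and
the Fisher–Sykes root brackets of `μ_4`:

|        | τ = 4        | τ = 6        | τ = 8        | τ = 10       |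
|--------|--------------|--------------|--------------|--------------|
| ℤ²     | [0.56, 0.61] | [0.42, 0.43] | [0.35, 0.36] | [0.30, 0.32] |
| ℤ³     | [0.70, 0.73] | [0.58, 0.60] | [0.52, 0.54] |              |
| ℤ⁴     | ≥ 0.77       | [0.68, 0.70] | (0, 0.65]    |              |

(measured: 0.5864 0.4255 0.3548 0.3112 / 0.7153 0.5935 0.5292 / 0.7802 0.6916 0.6472).  Consequences collected here:
**`loopCompat_table_rows`** — every row strictly decreasing (clause (c) `loopCompatStrictAntiMemory` at
`(d,m) ∈ {(2,2),(2,3),(2,4),(3,2),(3,3),(4,2),(4,3)}`); **`loopCompat_table_columns`** — `R_6(ℤ²) < R_6(ℤ³) < R_6(ℤ⁴)` and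
`R_8(ℤ²) < R_8(ℤ³)` (clause (b) `loopCompatStrictMonoDim` at `(2,3),(3,3),(2,4)`; `m = 2` for all `d` is …RungFourDimension);
**`loopCompat_table_window`** — all ten entries lie in `(0,1)` (clause (a) `loopCompatWindow`).

HONEST FRAMING: a summary of elementary consequences of kernel certificates; nothing here is used by a certified `p_c` cell.
Written by prim-pcint-2 gen 17 (prover-prim-pcint-2-g17-0), 2026-08-25.
-/

noncomputable section

open Literature.Probability.LatticeModels Literature.Probability.Percolation
open Summit.CriticalPhenomena.PercolationContinuityZ3.Theorems.Pcint

namespace Summit.CriticalPhenomena.PercolationContinuityZ3.Theorems.Pcint.MemoryTail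

/-- **Rows**: `R_10(ℤ²) < R_8(ℤ²) < R_6(ℤ²) < R_4(ℤ²)`, `R_8(ℤ³) < R_6(ℤ³) < R_4(ℤ³)`, `R_8(ℤ⁴) < R_6(ℤ⁴) < R_4(ℤ⁴)`. [this work] -/
theorem loopCompat_table_rows :
    (loopCompat 2 10 < loopCompat 2 8 ∧ loopCompat 2 8 < loopCompat 2 6 ∧ loopCompat 2 6 < loopCompat 2 4) ∧
    (loopCompat 3 8 < loopCompat 3 6 ∧ loopCompat 3 6 < loopCompat 3 4) ∧
    (loopCompat 4 8 < loopCompat 4 6 ∧ loopCompat 4 6 < loopCompat 4 4) :=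
  ⟨⟨loopCompat_chain4_zd2.1, loopCompat_chain4_zd2.2.1, loopCompat_chain4_zd2.2.2.1⟩,
    ⟨loopCompat_chain_zd3.1, loopCompat_chain_zd3.2.1⟩, loopCompat_chain_zd4⟩

/-- **Columns**: `R_6(ℤ²) < R_6(ℤ³) < R_6(ℤ⁴)` and `R_8(ℤ²) < R_8(ℤ³)`. [this work] -/
theorem loopCompat_table_columns :
    (loopCompat 2 6 < loopCompat 3 6 ∧ loopCompat 3 6 < loopCompat 4 6) ∧ loopCompat 2 8 < loopCompat 3 8 :=
  ⟨⟨loopCompat_six_zd2_lt_zd3, loopCompat_six_zd3_lt_zd4⟩, loopCompat_eight_zd2_lt_zd3⟩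

/-- **Window**: all ten certified entries lie in `(0, 1)`. [this work] -/
theorem loopCompat_table_window :
    (0 < loopCompat 2 4 ∧ loopCompat 2 4 < 1) ∧ (0 < loopCompat 2 6 ∧ loopCompat 2 6 < 1) ∧
    (0 < loopCompat 2 8 ∧ loopCompat 2 8 < 1) ∧ (0 < loopCompat 2 10 ∧ loopCompat 2 10 < 1) ∧
    (0 < loopCompat 3 4 ∧ loopCompat 3 4 < 1) ∧ (0 < loopCompat 3 6 ∧ loopCompat 3 6 < 1) ∧
    (0 < loopCompat 3 8 ∧ loopCompat 3 8 < 1) ∧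
    (0 < loopCompat 4 4 ∧ loopCompat 4 4 < 1) ∧ (0 < loopCompat 4 6 ∧ loopCompat 4 6 < 1) ∧
    (0 < loopCompat 4 8 ∧ loopCompat 4 8 < 1) := by
  refine ⟨⟨lt_of_lt_of_le (by norm_num) loopCompat_four_zd2_bounds.1, loopCompat_chain4_zd2.2.2.2⟩, loopCompatWindow_two.1,
    loopCompatWindow_two.2, loopCompatWindow_two_five,
    ⟨lt_of_lt_of_le (by norm_num) loopCompat_four_zd3_ge, loopCompat_chain_zd3.2.2⟩, loopCompatWindow_three_three,
    loopCompatWindow_three_four, ⟨lt_of_lt_of_le (by norm_num) loopCompat_four_zd4_ge, ?_⟩, loopCompatWindow_four_three,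
    loopCompatWindow_four_four⟩
  -- `R_4(ℤ⁴) < 1`: `R_4(ℤ⁴) = (2401/48)·ln(7/μ_4) ≤ (2401/48)(7/μ_4 − 1)` with `μ_4(ℤ⁴) ≥ 6.8916`
  rw [loopCompat_four_eq (d := 4) (by norm_num)]
  have hμlo := memGrowth_four_zd4_ge
  have hμpos : (0 : ℝ) < memGrowth 4 4 := by linarith
  have hq : (0 : ℝ) < (2 * ((4 : ℕ) : ℝ) - 1) / memGrowth 4 4 := div_pos (by norm_num) hμpos
  have hlog := Real.log_le_sub_one_of_pos hq
  have h1 : (2 * ((4 : ℕ) : ℝ) - 1) / memGrowth 4 4 ≤ 1.01573 := by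
    rw [div_le_iff₀ hμpos]; norm_num; linarith
  have hc' : (2 * ((4 : ℕ) : ℝ) - 1) ^ 4 / (2 * ((4 : ℕ) : ℝ) * (2 * ((4 : ℕ) : ℝ) - 2)) = 2401 / 48 := by norm_num
  rw [hc']
  nlinarith

end Summit.CriticalPhenomena.PercolationContinuityZ3.Theorems.Pcint.MemoryTail
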